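/-
Copyright (c) 2026 the pub-hodgecm-mathlib formalisation cell (harness21).  Prover seat hodgecm-mathlib-LH4-p13 (g2), req620 Track A «(D-RAM) FOUR-FRAME» squad
(heir LEAD F0P3a-plan lineage; dealer LH4-plan lineage; MS ROAD A, Stage B brick B4₂ «SPLIT STRATA, TYPE 2» (MEMO v2.1 §T2.2), FILE 4: AXIS 2).  2026-09-04.
-/
import Summits.HodgeConjecture.HodgeConjecture.Theorems.F0P3cDyRamDiagonalSplitCountTwoTools   -- B4₂ FILE 1 (this seat): type-2 Gram blocks; brings ★ B4 Tools
import Summits.HodgeConjecture.HodgeConjecture.Theorems.F0P3cDyRamDiagonalSplitCountAxisTwo    -- ★ B4 FILE 4 p855981 (this seat): the axis-2 engine (normalisation, stability, stabilisers, orbit, indices, weight)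
import HarnessLib

/-!
# Crux `H413`, MS ROAD A, STAGE B brick B4₂ «SPLIT STRATA, TYPE 2», FILE 4: THE AXIS-2 STRATUM AT ODD DEPTH — `M₂(s,y) = latt (1 0 0; 0 1 0; y 0 ϖ^s)` is TYPE-2 POLARISABLE
# iff `s` is odd; the polarisable stratum is the same unit-torus orbit as in ★ B4; WEIGHTED COUNT `q^{(s−1)∕2}` (= `q^(s∕2)` in `ℕ`)

Cell `hodgecm-mathlib` (D-0151), FLOOR 0, crux item H413 = `stmt-HodgeConjecture-24833`, route of record `HCCMUnconditional`; squad F0∕P3c∕LH4 (req618∕req620).  THEOREMS ONLY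
(no `def`, no instance, no notation, no `sorry`, default heartbeats); lane `--supports stmt-HodgeConjecture-24833 --as helper` (count-neutral).  Road target: tree
`Cruxes/H413/Lines/F0_P3c_DyRamFourFrame_U3_Laws.lean` stub `stub_U3_stableModelSum` (MS), type-2 half: B10₂ skeleton 08e5e6e2d02c47d3 (LH4-p10 (g2)) asks for
`stub_P_T2 : ∑ᶠ M ∈ stratum₂(T, (s,0,s)), 1∕[𝒰 : S_F(M)] = if ¬ 2 ∣ s ∧ s ≤ n₂ then q^(s∕2) else 0`, where «type-2 polarisable» means `∃ D` (`σ`-fixed, non-zero) with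
`IsVertexLattice σ ϖ (diag D) 2 M` (MEMO v2.1 §T2.4).  THIS FILE is the axis-2 engine of that twin; it REUSES the whole ★ B4 axis-2 engine (`F0P3cDyRamDiagonalSplitCountAxisTwo`:
normalisation, stability, stabilisers, the orbit formula, the two indices, the weight) — only the polarisation data change.

WHAT IS PROVED (generic valued field `K`; datum letters `(σ, ϖ, d)` as in ★ B1; `q = Nat.card 𝓀[K]`; `T = diag(α, β, γ)` with unit entries, `|α − γ| = |ϖ|^{n₂}`; the polarisability
predicate is written UNFOLDED).
* §1 (T₂²·a) `isTypeTwoPolarisable_latt_axis2` — for ODD `s = 2j+1` and a unit `y`, `M₂(s,y)` is a type-2 vertex lattice for `diag(−yσy·π₀^{−j}, 1, π₀^{−j})`, `π₀ = ϖσϖ` (Gram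
  `(0 0 a; 0 1 0; b 0 c)` with `|a| = |b| = |ϖ|`, `|c| = |ϖ|^{s+1}`: FILE 1); (T₂²·a′) `not_two_dvd_of_isTypeTwoPolarisable_latt_axis2` — conversely type-2 polarisable ⇒ `s` odd
  (★ `isVertexLattice_latt_iff_of_v` on the HNF frame: integrality of `G`, of `ϖG⁻¹` (explicit inverse) and `|det G| = |ϖ|²` pin the even valuations of `D₀, D₁, D₂` against `s`).
* §2 THE STRATUM `𝒮₂²(s) := {M ∈ 𝓛₀(T) | type-2 polarisable, M = M₂(s,y), |y| = 1}` EXHAUSTIVELY: `= 𝒯·M₂(s,1)` if `¬ 2 ∣ s ∧ s ≤ n₂`; `= ∅` if `n₂ < s` or `2 ∣ s`;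
  `ncard = (q−1)q^{s−1}`; HEAD **`finsum_stabiliserWeight_axis2StratumTwo`: `= q^(s∕2)`** (`¬ 2 ∣ s`, `s ≤ n₂`).
HONEST LABEL.  Count-neutral (`--supports`); nothing printed is asserted; (MS) and the census laws stay PROVER TARGETS until the Stage B bricks and B10∕B10₂ land; `HC_CM` is proved only
modulo the 7 printed citations (2 remaining named inputs: hLiu418 = `stmt-HodgeConjecture-24832`, h413 = `stmt-HodgeConjecture-24833`) until rung 0 closes.

## References
* [Jacobowitz1962] R. Jacobowitz, *Hermitian forms over local fields*, Amer. J. Math. 84 (1962), §7–§8 (`𝔭`-modular lattices; Gram matrices).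
* [Rogawski1990] J. D. Rogawski, *Automorphic Representations of Unitary Groups in Three Variables*, Ann. of Math. Stud. 123 (1990), §4.9 Prop. 4.9.1 (a) p. 55.
* [Kottwitz1986BaseChangeUnits] R. E. Kottwitz, *Base change for unit elements of Hecke algebras*, Compositio Math. 60 (1986), §1 pp. 240–241.
* [Serre1980Trees] J.-P. Serre, *Trees*, Springer (1980), Ch. II §1.1 (lattices, the diagonal action).
-/

set_option autoImplicit false

noncomputable section

namespace Summit.HodgeConjecture.HodgeConjecture.Cruxes.H413.F0P3cDyRamDiagonalSplitCountTwoAxisTwo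

open Matrix
open Literature.NumberTheory.Automorphic Literature.NumberTheory.Automorphic.HermitianLattice
open Literature.NumberTheory.Automorphic.UnitaryLatticeTree
open Literature.NumberTheory.LocalFields.WildQuadraticDatum (v_varpi_pow)
open Summit.HodgeConjecture.HodgeConjecture.Cruxes.H413.F0P3cDyRamDiagonalTorusDefs
open Summit.HodgeConjecture.HodgeConjecture.Cruxes.H413.F0P3cDyRamDiagonalStratumTools
open Summit.HodgeConjecture.HodgeConjecture.Cruxes.H413.F0P3cDyRamDiagonalSplitCountTwoTools
open Summit.HodgeConjecture.HodgeConjecture.Cruxes.H413.F0P3cDyRamDiagonalSplitCountAxisTwo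
open Summit.HodgeConjecture.HodgeConjecture.Cruxes.H413.F0P3cDyRamDiagonalGluedTubeCriterion (formCongr_hnf_diagonal det_coe_hnf det_formCongr_diagonal)
open Summit.HodgeConjecture.HodgeConjecture.Cruxes.H413.F0P3cDyRamDiagonalUnitTorusOrbit
open scoped Valued WithZero Matrix MatrixGroups

variable {K : Type*} [Field K] [Valued K ℤᵐ⁰]

/-! ## §1  Axis 2, type 2: polarisable iff the depth is odd -/

/-- **(T₂²·a) ODD DEPTH ⇒ TYPE-2 POLARISABLE**: for `s = 2j+1` and a unit `y`, `M₂(s,y) = latt (1 0 0; 0 1 0; y 0 ϖ^s)` is a TYPE-2 vertex lattice for the `σ`-fixed diagonal form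
`diag(−yσy·π₀^{−j}, 1, π₀^{−j})`, `π₀ = ϖσϖ` (Gram `(0 0 a; 0 1 0; b 0 c)`, `|a| = |b| = |ϖ|`, `|c| = |ϖ|^{s+1}`; MEMO v2.1 §T2.2). [cite: Jacobowitz1962, §7–§8] [cite: Rogawski1990, §4.9 Prop. 4.9.1 (a) p. 55] -/
theorem isTypeTwoPolarisable_latt_axis2 {σ : K →+* K} (hσ : ∀ a, σ (σ a) = a) (hvσ : ∀ a, Valued.v (σ a) = Valued.v a)
    {ϖ : K} (hϖ : Valued.v ϖ = WithZero.exp (-1 : ℤ)) {y : K} (hy : Valued.v y = 1) {s : ℕ} (hodd : ¬ 2 ∣ s) :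
    ∃ D : Fin 3 → K, (∀ i, σ (D i) = D i ∧ D i ≠ 0) ∧ IsVertexLattice σ ϖ (Matrix.diagonal D) 2 (latt (!![1, 0, 0; 0, 1, 0; y, 0, ϖ ^ s] : Matrix (Fin 3) (Fin 3) K)) := by
  obtain ⟨j, rfl⟩ : ∃ j, s = 2 * j + 1 := ⟨s / 2, by omega⟩
  have hϖ0 : ϖ ≠ 0 := fun h0 => by rw [h0, map_zero] at hϖ; exact WithZero.coe_ne_zero hϖ.symm
  have hϖ1 : Valued.v ϖ ≤ 1 := by rw [hϖ, ← WithZero.exp_zero, WithZero.exp_le_exp]; norm_num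
  have hσϖ0 : σ ϖ ≠ 0 := (map_ne_zero σ).2 hϖ0
  have hy0 : y ≠ 0 := fun h => by rw [h, map_zero] at hy; exact zero_ne_one hy
  set π₀ : K := ϖ * σ ϖ with hπ₀
  have hπ₀σ : σ π₀ = π₀ := by rw [hπ₀, map_mul, hσ, mul_comm]
  have hπ₀0 : π₀ ≠ 0 := mul_ne_zero hϖ0 hσϖ0
  set d₁ : K := (π₀ ^ j)⁻¹ with hd₁
  have hd₁σ : σ d₁ = d₁ := by rw [hd₁, map_inv₀, map_pow, hπ₀σ]
  have hd₁0 : d₁ ≠ 0 := inv_ne_zero (pow_ne_zero _ hπ₀0)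
  have hvϖ0 : Valued.v ϖ ≠ 0 := (Valuation.ne_zero_iff _).2 hϖ0
  have hvd₁p : Valued.v d₁ * Valued.v (ϖ ^ (2 * j + 1)) = Valued.v ϖ := by
    rw [hd₁, map_inv₀, map_pow, hπ₀, map_mul, hvσ, ← sq, map_pow, ← pow_mul, pow_succ, ← mul_assoc, inv_mul_cancel₀ (pow_ne_zero _ hvϖ0), one_mul]
  refine ⟨![-(σ y * d₁ * y), 1, d₁], ?_, ?_⟩
  · intro i
    fin_cases i
    · refine ⟨?_, ?_⟩
      · show σ (-(σ y * d₁ * y)) = -(σ y * d₁ * y)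
        rw [map_neg, map_mul, map_mul, hσ, hd₁σ]; ring
      · show -(σ y * d₁ * y) ≠ 0
        exact neg_ne_zero.2 (mul_ne_zero (mul_ne_zero ((map_ne_zero σ).2 hy0) hd₁0) hy0)
    · exact ⟨map_one σ, one_ne_zero⟩
    · exact ⟨hd₁σ, hd₁0⟩
  · have hG : formCongr σ (Matrix.GeneralLinearGroup.mkOfDetNeZero _ (det_axis2_ne_zero hϖ0 y (2 * j + 1))) (Matrix.diagonal ![-(σ y * d₁ * y), 1, d₁]) =
        !![0, 0, σ y * d₁ * ϖ ^ (2 * j + 1); 0, 1, 0; σ (ϖ ^ (2 * j + 1)) * d₁ * y, 0, σ (ϖ ^ (2 * j + 1)) * d₁ * ϖ ^ (2 * j + 1)] := by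
      rw [formCongr_hnf_diagonal σ _ 0 y 0 1 (ϖ ^ (2 * j + 1)) _ rfl]
      ext i j
      fin_cases i <;> fin_cases j <;> simp
    refine isVertexLattice_two_of_gram_eq_block₂ hϖ0 hϖ1 _ hG ?_ ?_ ?_ (map_one _)
    · rw [map_mul, map_mul, hvσ, hy, one_mul, hvd₁p]
    · rw [map_mul, map_mul, hvσ, hy, mul_one, mul_comm, hvd₁p]
    · rw [map_mul, map_mul, hvσ, mul_comm (Valued.v (ϖ ^ (2 * j + 1))) (Valued.v d₁), mul_assoc, mul_comm (Valued.v (ϖ ^ (2 * j + 1))),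
        ← mul_assoc, hvd₁p, map_pow]
      exact mul_le_of_le_one_right' (pow_le_one' hϖ1 _)

/-- **(T₂²·a′) TYPE-2 POLARISABLE ⇒ ODD DEPTH** (the Gram matrix on the HNF frame is `(D₀ + N(y)D₂, 0, σy·D₂ϖ^s; 0, D₁, 0; σϖ^s·D₂y, 0, N(ϖ^s)D₂)`; integrality of `G`, `ϖG⁻¹` and
`|det G| = |ϖ|²` pin the even valuations of `D₀, D₁, D₂` against `s`). [cite: Jacobowitz1962, §7–§8] [cite: Rogawski1990, §4.9 Prop. 4.9.1 (a) p. 55] -/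
theorem not_two_dvd_of_isTypeTwoPolarisable_latt_axis2 {σ : K →+* K} (hvσ : ∀ a, Valued.v (σ a) = Valued.v a)
    (hfix : ∀ x : K, σ x = x → x ≠ 0 → ∃ n : ℤ, Valued.v x = WithZero.exp (2 * n)) {ϖ : K} (hϖ : Valued.v ϖ = WithZero.exp (-1 : ℤ))
    {y : K} (hy : Valued.v y = 1) {s : ℕ}
    (hM : ∃ D : Fin 3 → K, (∀ i, σ (D i) = D i ∧ D i ≠ 0) ∧ IsVertexLattice σ ϖ (Matrix.diagonal D) 2 (latt (!![1, 0, 0; 0, 1, 0; y, 0, ϖ ^ s] : Matrix (Fin 3) (Fin 3) K))) :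
    ¬ 2 ∣ s := by
  obtain ⟨D, hD, hV⟩ := hM
  have hϖ0 : ϖ ≠ 0 := fun h0 => by rw [h0, map_zero] at hϖ; exact WithZero.coe_ne_zero hϖ.symm
  have hy0 : y ≠ 0 := fun h => by rw [h, map_zero] at hy; exact zero_ne_one hy
  have hσy : Valued.v (σ y) = 1 := by rw [hvσ, hy]
  have hvs : Valued.v (ϖ ^ s) = WithZero.exp (-(s : ℤ)) := by rw [map_pow, v_varpi_pow hϖ]
  have hσs : Valued.v (σ (ϖ ^ s)) = WithZero.exp (-(s : ℤ)) := by rw [hvσ, hvs]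
  obtain ⟨n₀, hn₀⟩ := hfix (D 0) (hD 0).1 (hD 0).2
  obtain ⟨n₁, hn₁⟩ := hfix (D 1) (hD 1).1 (hD 1).2
  obtain ⟨n₂, hn₂⟩ := hfix (D 2) (hD 2).1 (hD 2).2
  set g : GL (Fin 3) K := Matrix.GeneralLinearGroup.mkOfDetNeZero _ (det_axis2_ne_zero hϖ0 y s) with hg
  have hG : formCongr σ g (Matrix.diagonal D) =
      !![D 0 + σ y * D 2 * y, 0, σ y * D 2 * ϖ ^ s; 0, D 1, 0; σ (ϖ ^ s) * D 2 * y, 0, σ (ϖ ^ s) * D 2 * ϖ ^ s] := by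
    rw [formCongr_hnf_diagonal σ D 0 y 0 1 (ϖ ^ s) g rfl]
    ext i j
    fin_cases i <;> fin_cases j <;> simp
  obtain ⟨hint, hinv, hdet⟩ := (isVertexLattice_latt_iff_of_v σ hvσ hϖ0 (Matrix.diagonal D) 2 g).1 hV
  have hΔ0 : D 0 * D 2 * (σ (ϖ ^ s) * ϖ ^ s) ≠ 0 :=
    mul_ne_zero (mul_ne_zero (hD 0).2 (hD 2).2) (mul_ne_zero ((map_ne_zero σ).2 (pow_ne_zero _ hϖ0)) (pow_ne_zero _ hϖ0))
  have hdet' : (-(s : ℤ)) + (2 * n₀ + 2 * n₁ + 2 * n₂) + (-(s : ℤ)) = -1 + -1 := by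
    have h := hdet
    rw [det_formCongr_diagonal σ D g, det_coe_hnf 0 y 0 1 (ϖ ^ s) g rfl, one_mul, map_mul, map_mul, map_mul, map_mul, hσs, hn₀, hn₁, hn₂, hvs, hϖ,
      ← WithZero.exp_add, ← WithZero.exp_add, ← WithZero.exp_add, ← WithZero.exp_add, pow_two, ← WithZero.exp_add, WithZero.exp_inj] at h
    exact h
  have h02 : Valued.v (σ y * D 2 * ϖ ^ s) ≤ 1 := by have h := hint 0 2; rw [hG] at h; exact h
  have h00 : Valued.v (D 0 + σ y * D 2 * y) ≤ 1 := by have h := hint 0 0; rw [hG] at h; exact h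
  have h11 : Valued.v (D 1) ≤ 1 := by have h := hint 1 1; rw [hG] at h; exact h
  have hGinv : (formCongr σ g (Matrix.diagonal D))⁻¹ =
      !![σ (ϖ ^ s) * D 2 * ϖ ^ s / (D 0 * D 2 * (σ (ϖ ^ s) * ϖ ^ s)), 0, -(σ y * D 2 * ϖ ^ s) / (D 0 * D 2 * (σ (ϖ ^ s) * ϖ ^ s));
         0, (D 1)⁻¹, 0;
         -(σ (ϖ ^ s) * D 2 * y) / (D 0 * D 2 * (σ (ϖ ^ s) * ϖ ^ s)), 0, (D 0 + σ y * D 2 * y) / (D 0 * D 2 * (σ (ϖ ^ s) * ϖ ^ s))] := by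
    rw [hG]
    refine Matrix.inv_eq_right_inv ?_
    have h0 := (hD 0).2
    have h1 := (hD 1).2
    have h2 := (hD 2).2
    have hs0 : σ (ϖ ^ s) ≠ 0 := (map_ne_zero σ).2 (pow_ne_zero _ hϖ0)
    have hσϖ : σ ϖ ≠ 0 := (map_ne_zero σ).2 hϖ0
    have hp0 : (ϖ ^ s : K) ≠ 0 := pow_ne_zero _ hϖ0
    ext i j
    fin_cases i <;> fin_cases j <;> simp [Matrix.mul_apply, Fin.sum_univ_three] <;> field_simp <;> ring
  have i11 : Valued.v (ϖ * (D 1)⁻¹) ≤ 1 := by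
    have h := hinv 1 1; rw [hGinv, Matrix.smul_apply, smul_eq_mul] at h; exact h
  have i20 : Valued.v (ϖ * (-(σ (ϖ ^ s) * D 2 * y) / (D 0 * D 2 * (σ (ϖ ^ s) * ϖ ^ s)))) ≤ 1 := by
    have h := hinv 2 0; rw [hGinv, Matrix.smul_apply, smul_eq_mul] at h; exact h
  have i22 : Valued.v (ϖ * ((D 0 + σ y * D 2 * y) / (D 0 * D 2 * (σ (ϖ ^ s) * ϖ ^ s)))) ≤ 1 := by
    have h := hinv 2 2; rw [hGinv, Matrix.smul_apply, smul_eq_mul] at h; exact h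
  have hΔpos : 0 < Valued.v (D 0 * D 2 * (σ (ϖ ^ s) * ϖ ^ s)) := (Valuation.pos_iff _).2 hΔ0
  have vΔ : Valued.v (D 0 * D 2 * (σ (ϖ ^ s) * ϖ ^ s)) = WithZero.exp (2 * n₀ + 2 * n₂ + (-(s : ℤ) + -(s : ℤ))) := by
    rw [map_mul, map_mul, map_mul, hn₀, hn₂, hσs, hvs, ← WithZero.exp_add, ← WithZero.exp_add, ← WithZero.exp_add]
  have e11 : n₁ = 0 := by
    rw [hn₁, ← WithZero.exp_zero, WithZero.exp_le_exp] at h11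
    rw [map_mul, map_inv₀, hϖ, hn₁, ← WithZero.exp_neg, ← WithZero.exp_add, ← WithZero.exp_zero, WithZero.exp_le_exp] at i11
    omega
  have e02 : 2 * n₂ - (s : ℤ) ≤ 0 := by
    rw [map_mul, map_mul, hσy, one_mul, hn₂, hvs, ← WithZero.exp_add, ← WithZero.exp_zero, WithZero.exp_le_exp] at h02
    omega
  have e20 : (s : ℤ) - 1 ≤ 2 * n₀ := by
    rw [map_mul, map_div₀, ← mul_div_assoc, div_le_one₀ hΔpos, Valuation.map_neg, map_mul, map_mul, hσs, hn₂, hy, mul_one, hϖ, vΔ,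
      ← WithZero.exp_add, ← WithZero.exp_add, WithZero.exp_le_exp] at i20
    omega
  intro h2
  obtain ⟨m, rfl⟩ := h2
  have hlt : Valued.v (σ y * D 2 * y) < Valued.v (D 0) := by
    rw [map_mul, map_mul, hσy, hy, one_mul, mul_one, hn₂, hn₀, WithZero.exp_lt_exp]
    push_cast at hdet' e02 e20
    omega
  have e00 : n₀ ≤ 0 := by
    rw [Valuation.map_add_eq_of_lt_left _ hlt, hn₀, ← WithZero.exp_zero, WithZero.exp_le_exp] at h00
    omega
  have hg00 : Valued.v (D 0 + σ y * D 2 * y) = WithZero.exp (2 * n₀) := by rw [Valuation.map_add_eq_of_lt_left _ hlt, hn₀]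
  rw [map_mul, map_div₀, ← mul_div_assoc, div_le_one₀ hΔpos, hg00, hϖ, vΔ, ← WithZero.exp_add, WithZero.exp_le_exp] at i22
  push_cast at hdet' e02 e20 i22
  omega

/-! ## §2  Axis 2, type 2: the stratum `𝒮₂²(s)` is the unit-torus orbit of `M₂(s,1)` (odd `s ≤ n₂`), empty otherwise; its weighted count `q^(s∕2)` -/

/-- **(T₂²·g) THE TYPE-2 STRATUM IS A UNIT-TORUS ORBIT** (`s` odd, `s ≤ n₂`, `|α − γ| = |ϖ|^{n₂}`): `𝒮₂²(s) = 𝒯·M₃(s,1)`. [cite: Kottwitz1986BaseChangeUnits, §1 pp. 240–241] -/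
theorem axis2StratumTwo_eq_orbit {σ : K →+* K} (hσ : ∀ a, σ (σ a) = a) (hvσ : ∀ a, Valued.v (σ a) = Valued.v a)
    {ϖ : K} (hϖ : Valued.v ϖ = WithZero.exp (-1 : ℤ)) (T : GL (Fin 3) K) {α β γ : K} (hT : (T : Matrix (Fin 3) (Fin 3) K) = Matrix.diagonal ![α, β, γ])
    (hα : Valued.v α = 1) (hβ : Valued.v β = 1) (hγ : Valued.v γ = 1) {n₂ : ℕ} (h₂ : Valued.v (α - γ) = Valued.v ϖ ^ n₂) {s : ℕ} (hodd : ¬ 2 ∣ s) (hn : s ≤ n₂) :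
    {M : Submodule 𝒪[K] (Fin 3 → K) | M ∈ normalisedStableLattices T ∧
        (∃ D : Fin 3 → K, (∀ i, σ (D i) = D i ∧ D i ≠ 0) ∧ IsVertexLattice σ ϖ (Matrix.diagonal D) 2 M) ∧
        ∃ y : K, Valued.v y = 1 ∧ M = latt (!![1, 0, 0; 0, 1, 0; y, 0, ϖ ^ s] : Matrix (Fin 3) (Fin 3) K)} =
      {M | ∃ u ∈ unitTorus K 3, M = mapGL (diagGLUnits u) (latt (!![1, 0, 0; 0, 1, 0; 1, 0, ϖ ^ s] : Matrix (Fin 3) (Fin 3) K))} := by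
  have hϖ0 : ϖ ≠ 0 := fun h0 => by rw [h0, map_zero] at hϖ; exact WithZero.coe_ne_zero hϖ.symm
  have hϖ1 : Valued.v ϖ ≤ 1 := by rw [hϖ, ← WithZero.exp_zero, WithZero.exp_le_exp]; norm_num
  have hstab : Valued.v (γ - α) ≤ Valued.v (ϖ ^ s) := by
    rw [Valuation.map_sub_swap, h₂]; exact (F0P3cDyRamDiagonalStratumTools.v_pow_le_v_pow_iff hϖ s n₂).2 hn
  ext M
  simp only [Set.mem_setOf_eq]
  constructor
  · rintro ⟨-, -, y, hy, rfl⟩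
    have hy0 : y ≠ 0 := fun h => by rw [h, map_zero] at hy; exact zero_ne_one hy
    have hu : (![1, 1, Units.mk0 y hy0] : Fin 3 → Kˣ) ∈ unitTorus K 3 := by
      rw [mem_unitTorus_iff]; intro i; fin_cases i <;> simp [hy]
    refine ⟨![1, 1, Units.mk0 y hy0], hu, ?_⟩
    rw [mapGL_diagGLUnits_latt_axis2 hϖ0 hu 1 s]
    simp
  · rintro ⟨u, hu, rfl⟩
    rw [mapGL_diagGLUnits_latt_axis2 hϖ0 hu 1 s]
    have h0 := (mem_unitTorus_iff u).1 hu 0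
    have h2' := (mem_unitTorus_iff u).1 hu 2
    have hy : Valued.v ((u 2 : K) * 1 * ((u 0 : K))⁻¹) = 1 := by rw [map_mul, map_mul, map_inv₀, h0, h2', map_one]; simp
    refine ⟨⟨⟨Matrix.GeneralLinearGroup.mkOfDetNeZero _ (det_axis2_ne_zero hϖ0 _ s), rfl⟩, ?_, isNormalisedLattice_latt_axis2 hϖ1 hy s⟩,
      isTypeTwoPolarisable_latt_axis2 hσ hvσ hϖ hy hodd, _, hy, rfl⟩
    exact (mapGL_latt_axis2_eq_iff_of_diagonal hϖ0 hα hβ hγ T hT hy s).2 hstab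

/-- **(T₂²·h) EMPTY ABOVE THE DEPTH** (`n₂ < s`). [cite: Kottwitz1986BaseChangeUnits, §1 pp. 240–241] -/
theorem axis2StratumTwo_eq_empty (σ : K →+* K) {ϖ : K} (hϖ : Valued.v ϖ = WithZero.exp (-1 : ℤ)) (T : GL (Fin 3) K) {α β γ : K}
    (hT : (T : Matrix (Fin 3) (Fin 3) K) = Matrix.diagonal ![α, β, γ]) (hα : Valued.v α = 1) (hβ : Valued.v β = 1) (hγ : Valued.v γ = 1) {n₂ : ℕ}
    (h₂ : Valued.v (α - γ) = Valued.v ϖ ^ n₂) {s : ℕ} (hn : n₂ < s) :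
    {M : Submodule 𝒪[K] (Fin 3 → K) | M ∈ normalisedStableLattices T ∧
        (∃ D : Fin 3 → K, (∀ i, σ (D i) = D i ∧ D i ≠ 0) ∧ IsVertexLattice σ ϖ (Matrix.diagonal D) 2 M) ∧
        ∃ y : K, Valued.v y = 1 ∧ M = latt (!![1, 0, 0; 0, 1, 0; y, 0, ϖ ^ s] : Matrix (Fin 3) (Fin 3) K)} = ∅ := by
  have hϖ0 : ϖ ≠ 0 := fun h0 => by rw [h0, map_zero] at hϖ; exact WithZero.coe_ne_zero hϖ.symm
  refine Set.eq_empty_of_forall_notMem fun M ⟨⟨_, hTM, _⟩, _, y, hy, hM⟩ => ?_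
  have h := (mapGL_latt_axis2_eq_iff_of_diagonal hϖ0 hα hβ hγ T hT hy s).1 (hM ▸ hTM)
  rw [Valuation.map_sub_swap, h₂, F0P3cDyRamDiagonalStratumTools.v_pow_le_v_pow_iff hϖ] at h
  omega

/-- **(T₂²·h′) EMPTY AT EVEN DEPTH.** [cite: Jacobowitz1962, §7–§8] [cite: Rogawski1990, §4.9 Prop. 4.9.1 (a) p. 55] -/
theorem axis2StratumTwo_eq_empty_of_two_dvd {σ : K →+* K} (hvσ : ∀ a, Valued.v (σ a) = Valued.v a)
    (hfix : ∀ x : K, σ x = x → x ≠ 0 → ∃ n : ℤ, Valued.v x = WithZero.exp (2 * n)) {ϖ : K} (hϖ : Valued.v ϖ = WithZero.exp (-1 : ℤ))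
    (T : GL (Fin 3) K) {s : ℕ} (h2 : 2 ∣ s) :
    {M : Submodule 𝒪[K] (Fin 3 → K) | M ∈ normalisedStableLattices T ∧
        (∃ D : Fin 3 → K, (∀ i, σ (D i) = D i ∧ D i ≠ 0) ∧ IsVertexLattice σ ϖ (Matrix.diagonal D) 2 M) ∧
        ∃ y : K, Valued.v y = 1 ∧ M = latt (!![1, 0, 0; 0, 1, 0; y, 0, ϖ ^ s] : Matrix (Fin 3) (Fin 3) K)} = ∅ := by
  refine Set.eq_empty_of_forall_notMem fun M ⟨_, hD, y, hy, hM⟩ => ?_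
  exact not_two_dvd_of_isTypeTwoPolarisable_latt_axis2 hvσ hfix hϖ hy (hM ▸ hD) h2

/-- **(T₂²·i) `#𝒮₂²(s) = (q − 1)·q^{s−1}`** (`s` odd, `s ≤ n₂`). [cite: Kottwitz1986BaseChangeUnits, §1 pp. 240–241] [cite: Serre1979, Ch. IV §2 Prop. 6] -/
theorem ncard_axis2StratumTwo {σ : K →+* K} (hσ : ∀ a, σ (σ a) = a) (hvσ : ∀ a, Valued.v (σ a) = Valued.v a)
    {ϖ : K} (hϖ : Valued.v ϖ = WithZero.exp (-1 : ℤ)) [Finite 𝓀[K]] (T : GL (Fin 3) K) {α β γ : K}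
    (hT : (T : Matrix (Fin 3) (Fin 3) K) = Matrix.diagonal ![α, β, γ]) (hα : Valued.v α = 1) (hβ : Valued.v β = 1) (hγ : Valued.v γ = 1) {n₂ : ℕ}
    (h₂ : Valued.v (α - γ) = Valued.v ϖ ^ n₂) {s : ℕ} (hodd : ¬ 2 ∣ s) (hn : s ≤ n₂) :
    {M : Submodule 𝒪[K] (Fin 3 → K) | M ∈ normalisedStableLattices T ∧
        (∃ D : Fin 3 → K, (∀ i, σ (D i) = D i ∧ D i ≠ 0) ∧ IsVertexLattice σ ϖ (Matrix.diagonal D) 2 M) ∧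
        ∃ y : K, Valued.v y = 1 ∧ M = latt (!![1, 0, 0; 0, 1, 0; y, 0, ϖ ^ s] : Matrix (Fin 3) (Fin 3) K)}.ncard =
      (Nat.card 𝓀[K] - 1) * Nat.card 𝓀[K] ^ (s - 1) := by
  rw [axis2StratumTwo_eq_orbit hσ hvσ hϖ T hT hα hβ hγ h₂ hodd hn, ncard_unitTorus_orbit_eq_relIndex_unitStabilizer,
    relIndex_unitStabilizer_latt_axis2 hϖ (map_one _) (by omega)]

/-- **(T₂²) HEAD — THE WEIGHTED COUNT OF THE TYPE-2 AXIS-2 STRATUM IS `q^{(s−1)∕2}`** (`s` odd, `s ≤ n₂`; in `ℕ`, `(s−1)∕2 = s∕2`; MEMO v2.1 §T2.2):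
`#𝒮₂²(s) ∕ [𝒰 : S_F] = (q−1)q^{s−1} ∕ ((q−1)q^{(s−1)∕2})`. [cite: Rogawski1990, §4.9 Prop. 4.9.1 (a) p. 55] [cite: Kottwitz1986BaseChangeUnits, §1 pp. 240–241] -/
theorem finsum_stabiliserWeight_axis2StratumTwo {σ : K →+* K} (hσ : ∀ a, σ (σ a) = a) (hvσ : ∀ a, Valued.v (σ a) = Valued.v a)
    (hfix : ∀ x : K, σ x = x → x ≠ 0 → ∃ n : ℤ, Valued.v x = WithZero.exp (2 * n)) {ϖ : K} (hϖ : Valued.v ϖ = WithZero.exp (-1 : ℤ))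
    {d : ℕ} (hd : Valued.v (ϖ - σ ϖ) = Valued.v ϖ ^ d) [Finite 𝓀[K]] (T : GL (Fin 3) K) {α β γ : K}
    (hT : (T : Matrix (Fin 3) (Fin 3) K) = Matrix.diagonal ![α, β, γ]) (hα : Valued.v α = 1) (hβ : Valued.v β = 1) (hγ : Valued.v γ = 1) {n₂ : ℕ}
    (h₂ : Valued.v (α - γ) = Valued.v ϖ ^ n₂) {s : ℕ} (hodd : ¬ 2 ∣ s) (hn : s ≤ n₂) :
    ∑ᶠ M ∈ {M : Submodule 𝒪[K] (Fin 3 → K) | M ∈ normalisedStableLattices T ∧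
        (∃ D : Fin 3 → K, (∀ i, σ (D i) = D i ∧ D i ≠ 0) ∧ IsVertexLattice σ ϖ (Matrix.diagonal D) 2 M) ∧
        ∃ y : K, Valued.v y = 1 ∧ M = latt (!![1, 0, 0; 0, 1, 0; y, 0, ϖ ^ s] : Matrix (Fin 3) (Fin 3) K)}, stabiliserWeight σ M =
      (Nat.card 𝓀[K] : ℚ) ^ (s / 2) := by
  have hq : 1 < Nat.card 𝓀[K] := Finite.one_lt_card
  have hcard := ncard_axis2StratumTwo hσ hvσ hϖ T hT hα hβ hγ h₂ hodd hn
  have hfin : {M : Submodule 𝒪[K] (Fin 3 → K) | M ∈ normalisedStableLattices T ∧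
      (∃ D : Fin 3 → K, (∀ i, σ (D i) = D i ∧ D i ≠ 0) ∧ IsVertexLattice σ ϖ (Matrix.diagonal D) 2 M) ∧
      ∃ y : K, Valued.v y = 1 ∧ M = latt (!![1, 0, 0; 0, 1, 0; y, 0, ϖ ^ s] : Matrix (Fin 3) (Fin 3) K)}.Finite := by
    refine Set.finite_of_ncard_ne_zero ?_
    rw [hcard]
    exact mul_ne_zero (by omega) (pow_ne_zero _ (by omega))
  rw [finsum_mem_eq_ncard_mul hfin _ ((((Nat.card 𝓀[K] - 1) * Nat.card 𝓀[K] ^ ((s + 1) / 2 - 1) : ℕ) : ℚ))⁻¹ ?_, hcard]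
  · obtain ⟨j, rfl⟩ : ∃ j, s = 2 * j + 1 := ⟨s / 2, by omega⟩
    have e1 : (2 * j + 1 + 1) / 2 - 1 = j := by omega
    have e2 : (2 * j + 1) / 2 = j := by omega
    have e3 : 2 * j + 1 - 1 = j + j := by omega
    rw [e1, e2, e3, pow_add]
    have hq1 : ((Nat.card 𝓀[K] - 1 : ℕ) : ℚ) ≠ 0 := by
      rw [Nat.cast_ne_zero]; omega
    have hqj : ((Nat.card 𝓀[K] : ℚ)) ^ j ≠ 0 := pow_ne_zero _ (by rw [Nat.cast_ne_zero]; omega)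
    push_cast
    field_simp
  · intro M hM
    rw [axis2StratumTwo_eq_orbit hσ hvσ hϖ T hT hα hβ hγ h₂ hodd hn] at hM
    obtain ⟨u, -, rfl⟩ := hM
    rw [stabiliserWeight_mapGL_diagGLUnits, stabiliserWeight_latt_axis2 hσ hvσ hfix hϖ hd (map_one _) (by omega)]

end Summit.HodgeConjecture.HodgeConjecture.Cruxes.H413.F0P3cDyRamDiagonalSplitCountTwoAxisTwo

end
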